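import Summits.BirchSwinnertonDyer.Rank1Residual.AdditivePotMult.TwistSupply
import Literature.NumberTheory.EllipticCurves.QuadraticTwistLocalPolynomialProofs
import Literature.NumberTheory.EllipticCurves.QuadraticTwistPadicReduction
import Literature.NumberTheory.EllipticCurves.QuadraticTwistJInvariantProofs
import Literature.NumberTheory.EllipticCurves.RootNumberTwistProofs
import Literature.NumberTheory.DiophantineGeometry.LocalReductionProofs
import HarnessLib

/-!
# X3♯(M)/X4(M): the twist by `p*` of a potentially multiplicative curve is `p`-MULTIPLICATIVE — a globally minimal semistable twist model `W ≅ V^{(p*)}`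

HONEST FRAMING (cell `b2b-bsdres`, run/shared/lean/b2b/bsd-rank1-residual/, verbatim in every
file): the goal of the cell is to DELETE the COMBINATION-SHAPED residual classes of the
Birch–Swinnerton-Dyer formula for ALL analytic-rank `≤ 1` elliptic curves over `ℚ` — "full BSD
formula for every rank `≤ 1` curve in class `C`" assembled STRICTLY from published theorems — so
that the rank-`≤ 1` remainder becomes exactly the CONSTRUCTION-SHAPED classes, which are TYPED
(missing-input `Prop`s), NOT attempted. This is not "finishing BSD". Sub-cell
`b2b-bsdres-additive-p1` (CLASS-OWNERS row "X3/X4 additive — pot. multiplicative / X3♯(M)"),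
generation 6; research route, no claim beyond the stated sub-classes; X3♯(M) and X4(M) REMAIN
CONSTRUCTION-SHAPED; nothing is booked.

Theorems only; no definition, no named fact. The sub-cell's gen-0 object `PotMult W p`
(`Addv W p ∧ ord_p j(E) < 0`) was so far only known to admit SOME `p`-multiplicative quadratic
twist (`PotMult.exists_twist_mult`, Silverman *ATAEC* V.5.3). The branch-side line of seat
additive-p4 (V9b: `X4RankZeroTwist.missingUpperBoundAt_of_odd_prime_of_surj`, Delbourgo 1998
Prop. 4 + the typed `χ_p`-branch input) wants the SPECIFIC twist `V = E^{(p*)}`,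
`p* = (−1)^{⌊p/2⌋} p`, as a globally minimal `ℚ`-model SEMISTABLE at `p` with `W ≅ V^{(p*)}`.
This file supplies it for every potentially multiplicative pair at an odd prime:

* `mult_quadraticTwist_of_padicValRat_eq_zero` — at an odd `p`, a quadratic twist by a `p`-adic UNIT
  `u` preserves multiplicative reduction at `p` (Silverman *AEC* VII.5 Prop. 5.1(b): on a
  `ℤ_p`-minimal equation the twist by a unit is again minimal, with the same `v(Δ)` and `v(c₄)` —
  the tree's `isMinimal_quadraticTwist`, `hasMultiplicativeReduction_quadraticTwist_iff`);
* `PotMult.mult_quadraticTwist_pStar` — **`PotMult W p ⟹ Mult (W^{(p*)}) p`** (`p ≠ 2`): with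
  `E^{(d₀)}` multiplicative (V.5.3), `ord_p d₀` is odd (were it even, `E ≅ (E^{(d₀)})^{(unit)}`
  would be multiplicative, not additive), so `p*/d₀` is a unit times a square and
  `E^{(p*)} ≅ (E^{(d₀)})^{(unit)}` is multiplicative;
* `PotMult.exists_mult_pStar_twist_model` — a globally minimal `V/ℚ`, multiplicative at `p`, and
  `C` with `C • V^{(p*)} = W` (`V` = minimal model of `W^{(p*)}`; `(W^{(p*)})^{(p*)} = W^{(p*²)} ≅ W`);
  `ClassX4M.exists_mult_pStar_twist_model`, `ClassX3M.exists_mult_pStar_twist_model`.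

This is hypothesis (M) of Delbourgo, Compositio Math. 113 (1998) p. 133 ("`E` possesses
multiplicative reduction over `L ⊂ ℚ_p(μ_p)`, `[L:ℚ_p] = 2`", `L = ℚ_p(√p*)`) for EVERY additive
potentially multiplicative pair at odd `p`, as a kernel theorem. Labels UNCHANGED; nothing booked.
-/

noncomputable section

open scoped Classical

open WeierstrassCurve Literature.NumberTheory.EllipticCurves
  Literature.NumberTheory.EllipticCurves.Rank1Residual
  IsDedekindDomain

namespace Summit.BirchSwinnertonDyer.Rank1Residual.AdditivePotMult

variable {W : WeierstrassCurve ℚ} [W.IsElliptic] {p : ℕ} [hp : Fact p.Prime]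

/-! ### §1 A unit twist preserves multiplicative reduction at `p` -/

/-- **A quadratic twist by a `p`-adic unit preserves multiplicative reduction at the odd prime `p`.**
If `E/ℚ` is multiplicative at `p ≠ 2` and `u ∈ ℚ^×` has `ord_p u = 0`, then `E^{(u)}` is
multiplicative at `p`: the `ℤ_p`-minimal equation `X₁` of `E ⊗ ℚ_p` twisted by the unit `u` is a
`ℤ_p`-minimal equation of `E^{(u)} ⊗ ℚ_p` (`isMinimal_quadraticTwist`) with the same `v(Δ)`, `v(c₄)`
(`hasMultiplicativeReduction_quadraticTwist_iff`), and multiplicative reduction is read off any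
`ℚ_p`-isomorphic minimal equation (`hasMultiplicativeReduction_iff_of_isMinimal_of_eq_smul`).
(Split may become non-split: the unramified quadratic twist.)
[cite: SilvermanAEC2009, VII.5 Prop. 5.1(b) and VII.1 Prop. 1.3(b)] -/
theorem mult_quadraticTwist_of_padicValRat_eq_zero (hp2 : p ≠ 2) {u : ℚ} (hu0 : u ≠ 0)
    (hu : padicValRat p u = 0) (hm : Mult W p) : Mult (W.quadraticTwist u) p := by
  haveI := W.isElliptic_quadraticTwist hu0
  -- `u` is a `p`-adic unit
  have hnorm : ‖((u : ℚ) : ℚ_[p])‖ = 1 := by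
    rw [Padic.eq_padicNorm, padicNorm.eq_zpow_of_nonzero hu0, hu, neg_zero, zpow_zero,
      Rat.cast_one]
  set x : ℤ_[p] := ⟨((u : ℚ) : ℚ_[p]), hnorm.le⟩ with hx
  have hxu : IsUnit x := PadicInt.isUnit_iff.mpr (by rw [hx, PadicInt.norm_def]; exact hnorm)
  set d : ℤ_[p]ˣ := hxu.unit with hd
  have hdK : algebraMap ℤ_[p] ℚ_[p] (d : ℤ_[p]) = ((u : ℚ) : ℚ_[p]) := by
    rw [hd, IsUnit.unit_spec, hx]; rfl
  have h2 : IsUnit (2 : ℤ_[p]) := WeierstrassCurve.isUnit_two_padicInt hp2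
  -- the minimal model `X₁` of `E ⊗ ℚ_p` and its unit twist
  set X : WeierstrassCurve ℚ_[p] := W.baseChange ℚ_[p] with hXdef
  haveI : X.IsElliptic := inferInstanceAs (W.map (algebraMap ℚ ℚ_[p])).IsElliptic
  set D₁ : VariableChange ℚ_[p] := (X.exists_isMinimal ℤ_[p]).choose with hD₁
  have h₁ : X.minimal ℤ_[p] = D₁ • X := rfl
  haveI : (X.minimal ℤ_[p]).IsElliptic := by rw [h₁]; infer_instance
  haveI hmin : IsMinimal ℤ_[p] ((X.minimal ℤ_[p]).quadraticTwist (algebraMap ℤ_[p] ℚ_[p] (d : ℤ_[p]))) :=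
    isMinimal_quadraticTwist ℤ_[p] (X.minimal ℤ_[p]) h2 d
  have hm₁ : ((X.minimal ℤ_[p]).quadraticTwist
      (algebraMap ℤ_[p] ℚ_[p] (d : ℤ_[p]))).HasMultiplicativeReduction ℤ_[p] :=
    (hasMultiplicativeReduction_quadraticTwist_iff (R := ℤ_[p])).mpr hm
  haveI : ((X.minimal ℤ_[p]).quadraticTwist (algebraMap ℤ_[p] ℚ_[p] (d : ℤ_[p]))).IsElliptic :=
    (X.minimal ℤ_[p]).isElliptic_quadraticTwist (by rw [hdK]; exact_mod_cast hu0)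
  -- `E^{(u)} ⊗ ℚ_p = (D₁⁻¹ • X₁)^{(u)} = C' • X₁^{(u)}`
  set Y : WeierstrassCurve ℚ_[p] := (W.quadraticTwist u).baseChange ℚ_[p] with hYdef
  have hXback : X = D₁⁻¹ • X.minimal ℤ_[p] := by rw [h₁, smul_smul, inv_mul_cancel, one_smul]
  have hY : Y = (⟨D₁⁻¹.u, ((u : ℚ) : ℚ_[p]) * D₁⁻¹.r, 0, 0⟩ : VariableChange ℚ_[p]) •
      (X.minimal ℤ_[p]).quadraticTwist (algebraMap ℤ_[p] ℚ_[p] (d : ℤ_[p])) := by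
    rw [hYdef, baseChange, map_quadraticTwist, ← baseChange, ← hXdef, hdK, eq_ratCast]
    conv_lhs => rw [hXback]
    rw [quadraticTwist_smul]
  set D₂ : VariableChange ℚ_[p] := (Y.exists_isMinimal ℤ_[p]).choose with hD₂
  have h₂ : Y.minimal ℤ_[p] = D₂ • Y := rfl
  have h : Y.minimal ℤ_[p] =
      (D₂ * ⟨D₁⁻¹.u, ((u : ℚ) : ℚ_[p]) * D₁⁻¹.r, 0, 0⟩) •
        (X.minimal ℤ_[p]).quadraticTwist (algebraMap ℤ_[p] ℚ_[p] (d : ℤ_[p])) := by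
    rw [h₂, hY, mul_smul]
  have hΔ : ((X.minimal ℤ_[p]).quadraticTwist (algebraMap ℤ_[p] ℚ_[p] (d : ℤ_[p]))).Δ ≠ 0 :=
    ((X.minimal ℤ_[p]).quadraticTwist (algebraMap ℤ_[p] ℚ_[p] (d : ℤ_[p]))).isUnit_Δ.ne_zero
  unfold Mult HasMultiplicativeReductionAtPrime
  rw [← hYdef]
  exact (hasMultiplicativeReduction_iff_of_isMinimal_of_eq_smul ℤ_[p] h hΔ).mpr hm₁

/-- **Multiplicative reduction at `p` is preserved by any `ℚ`-model of a unit twist.** [folklore] -/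
theorem mult_of_model_unit_twist (hp2 : p ≠ 2) {u : ℚ} (hu0 : u ≠ 0) (hu : padicValRat p u = 0)
    (hm : Mult W p) {Wd : WeierstrassCurve ℚ} (hWd : ∃ C : VariableChange ℚ, C • W.quadraticTwist u = Wd) :
    Mult Wd p :=
  mult_of_model_twist hu0 (mult_quadraticTwist_of_padicValRat_eq_zero hp2 hu0 hu hm) hWd

/-! ### §2 `E` potentially multiplicative ⟹ `E^{(p*)}` multiplicative -/

omit [W.IsElliptic] in
/-- `p* = (−1)^{⌊p/2⌋} p ≠ 0` in `ℚ`. -/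
private theorem pStar_ne_zero : ((-1 : ℚ) ^ (p / 2) * p) ≠ 0 :=
  mul_ne_zero (pow_ne_zero _ (by norm_num)) (Nat.cast_ne_zero.mpr hp.out.ne_zero)

omit [W.IsElliptic] in
/-- `ord_p p* = 1`. -/
private theorem padicValRat_pStar : padicValRat p ((-1 : ℚ) ^ (p / 2) * p) = 1 := by
  rw [padicValRat.mul (pow_ne_zero _ (by norm_num)) (Nat.cast_ne_zero.mpr hp.out.ne_zero),
    padicValRat.pow, padicValRat.neg, padicValRat.one, mul_zero, zero_add,
    padicValRat.self hp.out.one_lt]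

/-- **An ADDITIVE curve is not a unit-times-square twist of a `p`-multiplicative one**: if `E` is
additive at the odd prime `p` and `E^{(d₀)}` is multiplicative at `p`, then `ord_p d₀` is ODD.
(Were `ord_p d₀ = 2j`, `u := d₀ p^{−2j}` would be a unit with `E^{(u)} ≅ E^{(d₀)}` multiplicative,
hence `E ≅ E^{(1)} = (E^{(u)})^{(u⁻¹)}` multiplicative — `exists_variableChange_quadraticTwist_mul_sq`,
`quadraticTwist_quadraticTwist`, `exists_variableChange_quadraticTwist_one`, §1.) [folklore] -/
theorem odd_padicValRat_of_addv_of_mult_twist (hp2 : p ≠ 2) (hadd : Addv W p) {d₀ : ℚ}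
    (hd0 : d₀ ≠ 0) (hm : Mult (W.quadraticTwist d₀) p) : Odd (padicValRat p d₀) := by
  rcases Int.even_or_odd (padicValRat p d₀) with ⟨j, hj⟩ | hodd
  · exfalso
    have hp0 : (p : ℚ) ≠ 0 := Nat.cast_ne_zero.mpr hp.out.ne_zero
    set e : ℚ := (p : ℚ) ^ (-j) with he
    have he0 : e ≠ 0 := zpow_ne_zero _ hp0
    set u : ℚ := d₀ * e ^ 2 with hudef
    have hu0 : u ≠ 0 := mul_ne_zero hd0 (pow_ne_zero _ he0)
    have hu : padicValRat p u = 0 := by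
      rw [hudef, padicValRat.mul hd0 (pow_ne_zero _ he0), padicValRat.pow, he, padicValRat.zpow,
        padicValRat.self hp.out.one_lt, hj]
      push_cast
      ring
    haveI := W.isElliptic_quadraticTwist hd0
    haveI := W.isElliptic_quadraticTwist hu0
    -- `E^{(u)} ≅ E^{(d₀)}` is multiplicative
    obtain ⟨C₁, hC₁⟩ := W.exists_variableChange_quadraticTwist_mul_sq d₀ e he0
    have hmu : Mult (W.quadraticTwist u) p := by
      rw [hudef, ← hC₁]
      exact (hasMultiplicativeReductionAtPrime_smul_iff (W.quadraticTwist d₀) C₁ p).mpr hm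
    -- `E ≅ E^{(1)} = (E^{(u)})^{(u⁻¹)}` is multiplicative: contradiction
    have hmu' : Mult ((W.quadraticTwist u).quadraticTwist u⁻¹) p :=
      mult_quadraticTwist_of_padicValRat_eq_zero hp2 (inv_ne_zero hu0)
        (by rw [padicValRat.inv, hu, neg_zero]) hmu
    rw [quadraticTwist_quadraticTwist, mul_inv_cancel₀ hu0] at hmu'
    obtain ⟨C₀, hC₀⟩ := W.exists_variableChange_quadraticTwist_one
    have hmW : Mult W p := by
      rw [← hC₀] at hmu'
      exact (hasMultiplicativeReductionAtPrime_smul_iff W C₀ p).mp hmu'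
    exact not_mult_of_addv W p hadd hmW
  · exact hodd

/-- **`E` potentially multiplicative at an odd `p` ⟹ `E^{(p*)}` is MULTIPLICATIVE at `p`**,
`p* = (−1)^{⌊p/2⌋} p`. With `E^{(d₀)}` multiplicative (Silverman *ATAEC* V.5.3,
`PotMult.exists_twist_mult`) and `ord_p d₀ = 2j + 1` (`odd_padicValRat_of_addv_of_mult_twist`),
`w := p*/(d₀ p^{−2j})` is a `p`-adic unit and `E^{(p*)} = (E^{(d₀ p^{−2j})})^{(w)} ≅ (E^{(d₀)})^{(w)}`
is multiplicative (§1). Equivalently: `E` acquires multiplicative reduction over `ℚ_p(√p*) ⊂ ℚ_p(μ_p)`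
— hypothesis (M) of Delbourgo 1998 (p. 133) holds for EVERY additive potentially multiplicative pair
at odd `p`. [cite: SilvermanATAEC1994, V.5.3] [cite: SilvermanAEC2009, VII.5 Prop. 5.1(b)] -/
theorem PotMult.mult_quadraticTwist_pStar (hpm : PotMult W p) (hp2 : p ≠ 2) :
    Mult (W.quadraticTwist ((-1 : ℚ) ^ (p / 2) * p)) p := by
  obtain ⟨d₀, hd0, hm0⟩ := hpm.exists_twist_mult
  obtain ⟨j, hj⟩ := odd_padicValRat_of_addv_of_mult_twist hp2 hpm.1 hd0 hm0
  have hp0 : (p : ℚ) ≠ 0 := Nat.cast_ne_zero.mpr hp.out.ne_zero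
  set e : ℚ := (p : ℚ) ^ (-j) with he
  have he0 : e ≠ 0 := zpow_ne_zero _ hp0
  set d₁ : ℚ := d₀ * e ^ 2 with hd₁
  have hd10 : d₁ ≠ 0 := mul_ne_zero hd0 (pow_ne_zero _ he0)
  have hd1v : padicValRat p d₁ = 1 := by
    rw [hd₁, padicValRat.mul hd0 (pow_ne_zero _ he0), padicValRat.pow, he, padicValRat.zpow,
      padicValRat.self hp.out.one_lt, hj]
    push_cast
    ring
  set w : ℚ := ((-1 : ℚ) ^ (p / 2) * p) / d₁ with hw
  have hw0 : w ≠ 0 := div_ne_zero pStar_ne_zero hd10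
  have hwv : padicValRat p w = 0 := by
    rw [hw, padicValRat.div pStar_ne_zero hd10, padicValRat_pStar, hd1v, sub_self]
  haveI := W.isElliptic_quadraticTwist hd0
  haveI := W.isElliptic_quadraticTwist hd10
  -- `E^{(d₁)} ≅ E^{(d₀)}` is multiplicative
  obtain ⟨C₁, hC₁⟩ := W.exists_variableChange_quadraticTwist_mul_sq d₀ e he0
  have hm1 : Mult (W.quadraticTwist d₁) p := by
    rw [hd₁, ← hC₁]
    exact (hasMultiplicativeReductionAtPrime_smul_iff (W.quadraticTwist d₀) C₁ p).mpr hm0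
  -- `E^{(p*)} = (E^{(d₁)})^{(w)}` on the nose, `w` a unit
  have hcomp : (W.quadraticTwist d₁).quadraticTwist w = W.quadraticTwist ((-1 : ℚ) ^ (p / 2) * p) := by
    rw [quadraticTwist_quadraticTwist, hw, mul_div_cancel₀ _ hd10]
  rw [← hcomp]
  exact mult_quadraticTwist_of_padicValRat_eq_zero hp2 hw0 hwv hm1

/-! ### §3 The globally minimal semistable twist model `W ≅ V^{(p*)}` -/

/-- **The semistable twist model of a potentially multiplicative pair.** For `E/ℚ` potentially
multiplicative at an odd `p` there are a globally minimal `V/ℚ`, MULTIPLICATIVE at `p`, and a change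
of variables `C` with `C • V^{(p*)} = W`, `p* = (−1)^{⌊p/2⌋} p`: `V` is a minimal model of `E^{(p*)}`
(§2; Néron, `exists_globallyMinimal_model_twist`) and `(E^{(p*)})^{(p*)} = E^{(p*·p*)} ≅ E^{(1)} ≅ E`
(`quadraticTwist_smul`, `quadraticTwist_quadraticTwist`, `exists_variableChange_quadraticTwist_mul_sq`,
`exists_variableChange_quadraticTwist_one`). This is exactly the datum `(V, C, Mult V p)` of seat
additive-p4's `X4RankZeroTwist.*` / `X3RankZeroTwist.*` theorems (line V9/V9b).
[cite: SilvermanATAEC1994, V.5.3] [cite: SilvermanAEC2009, VIII.8.3 and X.5 Cor. 5.4] -/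
theorem PotMult.exists_mult_pStar_twist_model (hpm : PotMult W p) (hp2 : p ≠ 2) :
    ∃ (V : WeierstrassCurve ℚ) (_ : V.IsElliptic) (_ : V.IsGloballyMinimal) (C : VariableChange ℚ),
      Mult V p ∧ C • V.quadraticTwist ((-1 : ℚ) ^ (p / 2) * p) = W := by
  set ps : ℚ := (-1 : ℚ) ^ (p / 2) * p with hps
  have hps0 : ps ≠ 0 := pStar_ne_zero
  obtain ⟨V, iV, iVm, C₁, hC₁⟩ := exists_globallyMinimal_model_twist W hps0
  have hmV : Mult V p := mult_of_model_twist hps0 (hpm.mult_quadraticTwist_pStar hp2) ⟨C₁, hC₁⟩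
  -- `V^{(p*)} = (C₁ • W^{(p*)})^{(p*)} = C' • W^{(p*·p*)}` and `W^{(1·p*²)} ≅ W^{(1)} ≅ W`
  haveI := W.isElliptic_quadraticTwist hps0
  obtain ⟨C₂, hC₂⟩ := W.exists_variableChange_quadraticTwist_mul_sq 1 ps hps0
  obtain ⟨C₀, hC₀⟩ := W.exists_variableChange_quadraticTwist_one
  have hV : V.quadraticTwist ps =
      ((⟨C₁.u, ps * C₁.r, 0, 0⟩ : VariableChange ℚ) * C₂ * C₀) • W := by
    rw [← hC₁, quadraticTwist_smul, quadraticTwist_quadraticTwist, mul_smul, mul_smul, hC₀, hC₂,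
      one_mul, sq]
  refine ⟨V, iV, iVm, ((⟨C₁.u, ps * C₁.r, 0, 0⟩ : VariableChange ℚ) * C₂ * C₀)⁻¹, hmV, ?_⟩
  rw [hV, smul_smul, inv_mul_cancel, one_smul]

/-- **X4(M): the semistable twist model** — for `(E,p) ∈ X4(M)` a globally minimal `V`,
multiplicative at `p`, with `C • V^{(p*)} = W`. [cite: SilvermanATAEC1994, V.5.3] -/
theorem ClassX4M.exists_mult_pStar_twist_model (hX : ClassX4M W p) :
    ∃ (V : WeierstrassCurve ℚ) (_ : V.IsElliptic) (_ : V.IsGloballyMinimal) (C : VariableChange ℚ),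
      Mult V p ∧ C • V.quadraticTwist ((-1 : ℚ) ^ (p / 2) * p) = W :=
  (ClassX4M.potMult W p hX).exists_mult_pStar_twist_model hX.p_ne_two

/-- **X3♯(M): the semistable twist model** — for `(E,p) ∈ X3♯(M)` a globally minimal `V`,
multiplicative at `p`, with `C • V^{(p*)} = W`. [cite: SilvermanATAEC1994, V.5.3] -/
theorem ClassX3M.exists_mult_pStar_twist_model [W.IsGloballyMinimal] (hX : ClassX3M W p) :
    ∃ (V : WeierstrassCurve ℚ) (_ : V.IsElliptic) (_ : V.IsGloballyMinimal) (C : VariableChange ℚ),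
      Mult V p ∧ C • V.quadraticTwist ((-1 : ℚ) ^ (p / 2) * p) = W :=
  (ClassX3M.potMult W p hX).exists_mult_pStar_twist_model (ClassX3M.p_ne_two W p hX)

/-! ### §4 Any `ℚ`-model `V` with `W ≅ V^{(p*)}` is `p`-multiplicative (the `hmult` binder of the branch-side theorems) -/

/-- **Every twist model is multiplicative**: if `E/ℚ` is potentially multiplicative at the odd prime
`p` and `V/ℚ` is ANY Weierstrass model with `C • V^{(p*)} = W`, then `V` is multiplicative at `p`
(`V ≅ W^{(p*)}` by `(V^{(p*)})^{(p*)} = V^{(p*²)} ≅ V`; §2 and model invariance). This discharges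
the `hmult : Mult V p` binder of seat additive-p4's branch-side theorems (`X4RankZeroTwist.*`,
`XMultRankZeroCyclotomicThree.*`, …) on X3♯(M)/X4(M) for whatever twist model `V` they are fed.
[cite: SilvermanATAEC1994, V.5.3] [cite: SilvermanAEC2009, X.5 Cor. 5.4] -/
theorem PotMult.mult_of_twist_model_pStar (hpm : PotMult W p) (hp2 : p ≠ 2)
    (V : WeierstrassCurve ℚ) [V.IsElliptic] (C : VariableChange ℚ)
    (hC : C • V.quadraticTwist ((-1 : ℚ) ^ (p / 2) * p) = W) : Mult V p := by
  set ps : ℚ := (-1 : ℚ) ^ (p / 2) * p with hps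
  have hps0 : ps ≠ 0 := pStar_ne_zero
  haveI := V.isElliptic_quadraticTwist hps0
  -- `W^{(p*)} = (C • V^{(p*)})^{(p*)} = C' • V^{(p*·p*)}` and `V^{(1·p*²)} ≅ V^{(1)} ≅ V`
  obtain ⟨C₂, hC₂⟩ := V.exists_variableChange_quadraticTwist_mul_sq 1 ps hps0
  obtain ⟨C₀, hC₀⟩ := V.exists_variableChange_quadraticTwist_one
  have hW : W.quadraticTwist ps = ((⟨C.u, ps * C.r, 0, 0⟩ : VariableChange ℚ) * C₂ * C₀) • V := by
    rw [← hC, quadraticTwist_smul, quadraticTwist_quadraticTwist, mul_smul, mul_smul, hC₀, hC₂,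
      one_mul, sq]
  have hm : Mult (W.quadraticTwist ps) p := hpm.mult_quadraticTwist_pStar hp2
  rw [hW] at hm
  exact (hasMultiplicativeReductionAtPrime_smul_iff V _ p).mp hm

/-- **X4(M): any twist model `V` with `C • V^{(p*)} = W` is `p`-multiplicative.** [cite: SilvermanATAEC1994, V.5.3] -/
theorem ClassX4M.mult_of_twist_model_pStar (hX : ClassX4M W p)
    (V : WeierstrassCurve ℚ) [V.IsElliptic] (C : VariableChange ℚ)
    (hC : C • V.quadraticTwist ((-1 : ℚ) ^ (p / 2) * p) = W) : Mult V p :=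
  (ClassX4M.potMult W p hX).mult_of_twist_model_pStar hX.p_ne_two V C hC

/-- **X3♯(M): any twist model `V` with `C • V^{(p*)} = W` is `p`-multiplicative.** [cite: SilvermanATAEC1994, V.5.3] -/
theorem ClassX3M.mult_of_twist_model_pStar [W.IsGloballyMinimal] (hX : ClassX3M W p)
    (V : WeierstrassCurve ℚ) [V.IsElliptic] (C : VariableChange ℚ)
    (hC : C • V.quadraticTwist ((-1 : ℚ) ^ (p / 2) * p) = W) : Mult V p :=
  (ClassX3M.potMult W p hX).mult_of_twist_model_pStar (ClassX3M.p_ne_two W p hX) V C hC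

/-- **At `p = 3`: `p* = −3`**, so the twist models of additive-p4's `ℚ(ζ₃)` lines V15/V16
(`C • V.quadraticTwist (-3) = W`) are covered: `Mult V 3` for every such `V` on X4(M).
[cite: SilvermanATAEC1994, V.5.3] -/
theorem ClassX4M.mult_of_twist_model_negThree {W : WeierstrassCurve ℚ} [W.IsElliptic]
    [Fact (Nat.Prime 3)] (hX : ClassX4M W 3) (V : WeierstrassCurve ℚ) [V.IsElliptic]
    (C : VariableChange ℚ) (hC : C • V.quadraticTwist (-3 : ℚ) = W) : Mult V 3 :=
  ClassX4M.mult_of_twist_model_pStar hX V C (by norm_num [hC])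

/-- **At `p = 3`, X3♯(M)**: `Mult V 3` for every `V` with `C • V^{(−3)} = W`. [cite: SilvermanATAEC1994, V.5.3] -/
theorem ClassX3M.mult_of_twist_model_negThree {W : WeierstrassCurve ℚ} [W.IsElliptic]
    [W.IsGloballyMinimal] [Fact (Nat.Prime 3)] (hX : ClassX3M W 3) (V : WeierstrassCurve ℚ)
    [V.IsElliptic] (C : VariableChange ℚ) (hC : C • V.quadraticTwist (-3 : ℚ) = W) : Mult V 3 :=
  ClassX3M.mult_of_twist_model_pStar hX V C (by norm_num [hC])

end Summit.BirchSwinnertonDyer.Rank1Residual.AdditivePotMult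

end
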